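import Mathlib
import HarnessLib
import Summits.NavierStokesRegularity.NavierStokesRegularity.Theorems.QuarterLogPincerColdSmoothingDefs
import Summits.NavierStokesRegularity.NavierStokesRegularity.Theorems.QuarterLogPincerTypeIQuantSubcubicExpStubUniformScaledEnergy
import Summits.NavierStokesRegularity.NavierStokesRegularity.Theorems.QuarterLogPincerTypeIQuantSubcubicExpFrameTools
import Literature.Analysis.FluidPDE.SereginSverakPressureProofs
import Literature.Analysis.FluidPDE.ClassicalSuitable
import Literature.Analysis.FluidPDE.SpaceTimeCalculusC1
import Literature.Analysis.FluidPDE.ChaeAsymptoticallySelfSimilarLocalLeray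

/-!
# Route `QuarterLogPincer`, crux `TypeIQuantSubcubicExp` (stmt-NavierStokesRegularity-24077), line `cold_smoothing` —
# CS2, the `D`-half: the ball-gauged pressure has bounded scaled `L^{3/2}` quantity (`cknD ≤ C₂(M)`)

The plumbing stub CS2 `ColdSmoothing.ColdPressureGauge` of ns-idea-7's `Lines/cold_smoothing.lean` (v1.1) asks, for a backward cylinder
`Q_ρ(z)` with `ρ² ≤ z₁ ≤ T` in the frame with rate `M`, (a) suitability of `(u, p̃)` in every `Q_{ρ'}(z)`, `ρ' ≤ ρ`, for the BALL-GAUGED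
pressure `p̃ = ballGauge p z₂ ρ`, and (b) `cknD ρ z p̃ ≤ C₂(M)`.  This file proves HALF (b) — `cknD_ballGauge_le` — exactly as the card
says: restrict the frame to `[0, z₁]` (`ThinCascade.frame_restrict`, `typeI_restrict`), read the D-clause of I1
`ThinCascade.stub_uniformScaledEnergy` at vertex `z₁`, radius `ρ`, centre `z₂` (`∫_{z₁−ρ²}^{z₁}∫_{B_ρ(z₂)}|p − ⨍_{B_ρ}p|^{3/2} ≤ Cρ²`), and
pass from the product integral to the iterated one by the INEQUALITY `lintegral_prod_le` (no measurability needed), `Ioo ⊂ Icc`;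
`C₂ := max(C,0) + 1`.  Half (a) (classical ⇒ suitable weak in the parabolic ball with a time-dependent gauge) is NOT proved here.

HONEST FRAME: bookkeeping for HYPOTHETICAL Type-I classical solutions over the tree theorem I1; a helper toward one registered plumbing
stub; nothing here bears on 24077's truth, W7 or Navier–Stokes regularity (OPEN / not proved).  pub-ns-dss typer (g38),
`--supports stmt-NavierStokesRegularity-24077`.
-/

noncomputable section

set_option linter.dupNamespace false

namespace Summit.NavierStokesRegularity.NavierStokesRegularity.Cruxes.TypeIQuantSubcubicExp.ColdSmoothing

open MeasureTheory Set Function Filter Topology Metric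
open scoped ENNReal NNReal
open Literature.Analysis Literature.Analysis.FluidPDE
open Summit.NavierStokesRegularity.NavierStokesRegularity.Theorems.ThinCascade (frame_restrict typeI_restrict)
open Summit.NavierStokesRegularity.NavierStokesRegularity.Cruxes.TypeIQuantSubcubicExp.ThinCascade (stub_uniformScaledEnergy)

/-- **CS2, half (b): `cknD ρ z (ballGauge p z₂ ρ) ≤ C₂(M)`** for every backward cylinder `Q_ρ(z)` with `ρ² ≤ z₁ ≤ T` in the
frame with rate `M` (`C₂ := max(C,0) + 1`, `C = C(M)` the constant of I1 `ThinCascade.stub_uniformScaledEnergy`). -/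
theorem cknD_ballGauge_le (M : ℝ) :
    ∃ C₂ : ℝ, 0 < C₂ ∧
      ∀ (T τ : ℝ) (u : ℝ → (EuclideanSpace ℝ (Fin 3)) → (EuclideanSpace ℝ (Fin 3)))
        (p : ℝ → (EuclideanSpace ℝ (Fin 3)) → ℝ), Frame T u p → 0 < τ → Rate M T τ u →
        ∀ (z : ℝ × (EuclideanSpace ℝ (Fin 3))) (ρ : ℝ), 0 < ρ → ρ ^ 2 ≤ z.1 → z.1 ≤ T →
          cknD ρ z (ballGauge p z.2 ρ) ≤ ENNReal.ofReal C₂ := by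
  obtain ⟨C, hC⟩ := stub_uniformScaledEnergy M
  refine ⟨max C 0 + 1, by positivity, ?_⟩
  intro T τ u p hframe hτ hrate z ρ hρ hρz hzT
  have hρ2 : 0 < ρ ^ 2 := by positivity
  have hz0 : 0 < z.1 := lt_of_lt_of_le hρ2 hρz
  -- I1 (D-clause) at vertex `z.1`, radius `ρ`, centre `z.2`, for the frame restricted to `[0, z.1]`
  have hfr' := frame_restrict hframe hz0 hzT
  have hrate' := typeI_restrict hrate hzT
  have hτ' : 0 < T - z.1 + τ := by linarith
  obtain ⟨-, -, hD⟩ := hC z.1 (T - z.1 + τ) u p hfr' hτ' hrate' z.2 ρ hρ hρz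
  have hC0 : C ≤ max C 0 := le_max_left _ _
  have hm0 : 0 ≤ max C 0 := le_max_right _ _
  -- the integrand of `cknD` is the integrand of the D-clause
  have hint : ∀ t y, ‖ballGauge p z.2 ρ t y‖ₑ ^ (3 / 2 : ℝ) =
      ENNReal.ofReal (|p t y - ⨍ w in ball z.2 ρ, p t w| ^ (3 / 2 : ℝ)) := by
    intro t y
    rw [ballGauge, Real.enorm_eq_ofReal_abs, ENNReal.ofReal_rpow_of_nonneg (abs_nonneg _) (by norm_num)]
  -- Tonelli (inequality form) and `Ioo ⊂ Icc`
  have hprod : ∫⁻ q in parabolicCylinder ρ z, ‖ballGauge p z.2 ρ q.1 q.2‖ₑ ^ (3 / 2 : ℝ) ≤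
      ENNReal.ofReal (C * ρ ^ 2) := by
    rw [parabolicCylinder, Measure.volume_eq_prod, ← Measure.prod_restrict]
    refine (lintegral_prod_le _).trans ?_
    calc ∫⁻ t in Ioo (z.1 - ρ ^ 2) z.1, ∫⁻ y in ball z.2 ρ, ‖ballGauge p z.2 ρ t y‖ₑ ^ (3 / 2 : ℝ)
        ≤ ∫⁻ t in Icc (z.1 - ρ ^ 2) z.1, ∫⁻ y in ball z.2 ρ, ‖ballGauge p z.2 ρ t y‖ₑ ^ (3 / 2 : ℝ) :=
          lintegral_mono_set Ioo_subset_Icc_self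
      _ = ∫⁻ t in Icc (z.1 - ρ ^ 2) z.1, ∫⁻ y in ball z.2 ρ,
            ENNReal.ofReal (|p t y - ⨍ w in ball z.2 ρ, p t w| ^ (3 / 2 : ℝ)) := by
          simp_rw [hint]
      _ ≤ ENNReal.ofReal (C * ρ ^ 2) := hD
  -- normalisation by `ρ⁻²`
  unfold cknD
  have hρne : ENNReal.ofReal ρ ^ 2 ≠ 0 := pow_ne_zero _ (ENNReal.ofReal_pos.2 hρ).ne'
  have hρtop : ENNReal.ofReal ρ ^ 2 ≠ ⊤ := ENNReal.pow_ne_top ENNReal.ofReal_ne_top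
  calc (ENNReal.ofReal ρ ^ 2)⁻¹ * ∫⁻ q in parabolicCylinder ρ z, ‖ballGauge p z.2 ρ q.1 q.2‖ₑ ^ (3 / 2 : ℝ)
      ≤ (ENNReal.ofReal ρ ^ 2)⁻¹ * ENNReal.ofReal (C * ρ ^ 2) := mul_le_mul' le_rfl hprod
    _ ≤ (ENNReal.ofReal ρ ^ 2)⁻¹ * ENNReal.ofReal (max C 0 * ρ ^ 2) :=
        mul_le_mul' le_rfl (ENNReal.ofReal_le_ofReal (mul_le_mul_of_nonneg_right hC0 hρ2.le))
    _ = (ENNReal.ofReal ρ ^ 2)⁻¹ * (ENNReal.ofReal ρ ^ 2 * ENNReal.ofReal (max C 0)) := by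
        rw [← ENNReal.ofReal_pow hρ.le, ← ENNReal.ofReal_mul (sq_nonneg ρ), mul_comm (ρ ^ 2)]
    _ = ENNReal.ofReal (max C 0) := by
        rw [← mul_assoc, ENNReal.inv_mul_cancel hρne hρtop, one_mul]
    _ ≤ ENNReal.ofReal (max C 0 + 1) := ENNReal.ofReal_le_ofReal (by linarith)

/-! ### Half (a): classical solutions with the ball-gauged pressure are suitable weak solutions in the parabolic ball -/

/-- The ball average `t ↦ ⨍_{B(x,ρ)} p(t)` of the pressure of the frame is continuous on `[0,T]` (dominated convergence; `p` is
jointly continuous on `[0,T] × ℝ³`). -/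
theorem continuousOn_ballAverage {T : ℝ} {u : ℝ → (EuclideanSpace ℝ (Fin 3)) → (EuclideanSpace ℝ (Fin 3))}
    {p : ℝ → (EuclideanSpace ℝ (Fin 3)) → ℝ} (hframe : Frame T u p) (hT : 0 ≤ T)
    (x : EuclideanSpace ℝ (Fin 3)) (ρ : ℝ) :
    ContinuousOn (fun t => ⨍ w in ball x ρ, p t w) (Icc 0 T) := by
  have hpc : ContinuousOn (uncurry p) (Icc 0 T ×ˢ univ) := hframe.1.smooth_pressure.continuousOn
  -- the pressure extended across the time boundary by projection onto `[0,T]`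
  set P : ℝ → (EuclideanSpace ℝ (Fin 3)) → ℝ := fun t w => p (projIcc 0 T hT t : ℝ) w with hP
  have hPc : Continuous (uncurry P) := by
    have e : uncurry P = uncurry p ∘ fun q : ℝ × (EuclideanSpace ℝ (Fin 3)) =>
        ((projIcc 0 T hT q.1 : ℝ), q.2) := by
      funext q; rfl
    rw [e]
    exact hpc.comp_continuous
      ((continuous_subtype_val.comp (continuous_projIcc.comp continuous_fst)).prodMk continuous_snd)
      fun q => ⟨(projIcc 0 T hT q.1).2, mem_univ _⟩
  -- a uniform bound on `[0,T] × B̄(x,ρ)`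
  obtain ⟨B, hB⟩ := (isCompact_Icc.prod (isCompact_closedBall x ρ)).exists_bound_of_continuousOn
    (hpc.mono (prod_mono le_rfl (subset_univ _)))
  have hcont : Continuous fun t => ∫ w in ball x ρ, P t w := by
    refine continuous_of_dominated (bound := fun _ => B) (fun t => ?_) (fun t => ?_) ?_ ?_
    · exact (hPc.comp (continuous_const.prodMk continuous_id)).aestronglyMeasurable
    · refine (ae_restrict_mem measurableSet_ball).mono fun w hw => ?_
      exact hB ((projIcc 0 T hT t : ℝ), w) ⟨(projIcc 0 T hT t).2, ball_subset_closedBall hw⟩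
    · exact integrableOn_const measure_ball_lt_top.ne
    · exact ae_of_all _ fun w => hPc.comp (continuous_id.prodMk continuous_const)
  have hcont' : Continuous fun t => ⨍ w in ball x ρ, P t w := by
    simp_rw [setAverage_eq, smul_eq_mul]
    exact continuous_const.mul hcont
  refine hcont'.continuousOn.congr fun t ht => ?_
  have e : P t = p t := by
    funext w
    simp only [hP, projIcc_of_mem hT ht]
  simp only [e]

/-- **CS2, half (a): `(u, ballGauge p z₂ ρ)` is a suitable weak solution in every parabolic ball `Q_{ρ'}(z)`**, `0 < ρ'`,
`ρ'² ≤ z₁ ≤ T`, for the frame (classical on `[0,T] × ℝ³`) with a Type-I rate (the rate only supplies the `L^∞_t L²_x` class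
cheaply).  Interior conditions by the tree's `isSuitableWeakSolutionOn_of_classical` and the time-dependent gauge
`IsSuitableWeakSolutionOn.sub_pressure`; the weak gradient is the classical one (`hasWeakSpatialGradientOn_of_contDiffOn`); the
global classes from continuity on the compact closure of the cylinder. -/
theorem isSuitableWeakSolutionInBall_ballGauge {M T τ : ℝ}
    {u : ℝ → (EuclideanSpace ℝ (Fin 3)) → (EuclideanSpace ℝ (Fin 3))} {p : ℝ → (EuclideanSpace ℝ (Fin 3)) → ℝ}
    (hframe : Frame T u p) (hτ : 0 < τ) (hrate : Rate M T τ u) {z : ℝ × (EuclideanSpace ℝ (Fin 3))} {ρ ρ' : ℝ}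
    (hρ' : 0 < ρ') (hρ'z : ρ' ^ 2 ≤ z.1) (hzT : z.1 ≤ T) :
    IsSuitableWeakSolutionInBall ρ' z u (ballGauge p z.2 ρ) := by
  have hρ2 : 0 < ρ' ^ 2 := by positivity
  have hz0 : 0 < z.1 := lt_of_lt_of_le hρ2 hρ'z
  have hT : 0 < T := lt_of_lt_of_le hz0 hzT
  -- the cylinder sits inside `(0,T) × ℝ³` and inside the compact box `K = [z₁ − ρ'², z₁] × B̄(z₂, ρ')`
  have hQ : (parabolicCylinderOpens ρ' z : Set (ℝ × (EuclideanSpace ℝ (Fin 3)))) ⊆ Ioo 0 T ×ˢ univ := by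
    intro q hq
    have hq' : q ∈ parabolicCylinder ρ' z := hq
    rw [mem_parabolicCylinder] at hq'
    exact ⟨⟨by linarith [hq'.1.1], by linarith [hq'.1.2]⟩, mem_univ _⟩
  set K : Set (ℝ × (EuclideanSpace ℝ (Fin 3))) := Icc (z.1 - ρ' ^ 2) z.1 ×ˢ closedBall z.2 ρ' with hK
  have hKc : IsCompact K := isCompact_Icc.prod (isCompact_closedBall _ _)
  have hQK : parabolicCylinder ρ' z ⊆ K := by
    intro q hq
    rw [mem_parabolicCylinder] at hq
    exact ⟨⟨hq.1.1.le, hq.1.2.le⟩, mem_closedBall.2 hq.2.le⟩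
  have hKI : K ⊆ Icc 0 T ×ˢ univ := by
    intro q hq
    exact ⟨⟨by linarith [hq.1.1], hq.1.2.trans hzT⟩, mem_univ _⟩
  have hQfin : volume (parabolicCylinder ρ' z) ≠ ⊤ :=
    ((measure_mono hQK).trans_lt hKc.measure_lt_top).ne
  -- the classical data
  have hcl : IsClassicalNSSolutionOn (Icc 0 T) 1 0 u p := hframe.1
  have hclo : IsClassicalNSSolutionOn (Ico 0 T) 1 0 u p := hcl.mono Ico_subset_Icc_self (uniqueDiffOn_Ico 0 T)
  have hu1 : ContDiffOn ℝ 1 (uncurry u) (Icc 0 T ×ˢ univ) := hcl.smooth_velocity.of_le (by norm_cast)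
  have hu1o : ContDiffOn ℝ 1 (uncurry u) (Ioo 0 T ×ˢ univ) := hu1.mono (prod_mono Ioo_subset_Icc_self le_rfl)
  have hpc : ContinuousOn (uncurry p) (Icc 0 T ×ˢ univ) := hcl.smooth_pressure.continuousOn
  -- the gauge `c(t) = ⨍_{B(z₂,ρ)} p(t)` is continuous on `[0,T]`, hence bounded and locally integrable on the cylinder
  set c : ℝ → ℝ := fun t => ⨍ w in ball z.2 ρ, p t w with hc
  have hcc : ContinuousOn c (Icc 0 T) := continuousOn_ballAverage hframe hT.le z.2 ρ
  obtain ⟨Bc, hBc⟩ := isCompact_Icc.exists_bound_of_continuousOn hcc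
  have hcQ : ContinuousOn (fun q : ℝ × (EuclideanSpace ℝ (Fin 3)) => c q.1)
      (parabolicCylinderOpens ρ' z : Set (ℝ × (EuclideanSpace ℝ (Fin 3)))) :=
    (hcc.comp continuous_fst.continuousOn fun q hq => Ioo_subset_Icc_self (hQ hq).1)
  have hli : LocallyIntegrableOn (fun q : ℝ × (EuclideanSpace ℝ (Fin 3)) => c q.1)
      (parabolicCylinderOpens ρ' z : Set (ℝ × (EuclideanSpace ℝ (Fin 3)))) volume :=
    hcQ.locallyIntegrableOn (parabolicCylinderOpens ρ' z).isOpen.measurableSet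
  have hc32 : ∀ K' ⊆ (parabolicCylinderOpens ρ' z : Set (ℝ × (EuclideanSpace ℝ (Fin 3)))), IsCompact K' →
      ∫⁻ q in K', ‖c q.1‖ₑ ^ (3 / 2 : ℝ) < ⊤ := by
    intro K' hK'Q hK'
    have hle : ∫⁻ q in K', ‖c q.1‖ₑ ^ (3 / 2 : ℝ) ≤ ∫⁻ _ in K', ENNReal.ofReal Bc ^ (3 / 2 : ℝ) := by
      refine setLIntegral_mono' hK'.measurableSet fun q hq => ?_
      have hq1 : q.1 ∈ Icc 0 T := Ioo_subset_Icc_self (hQ (hK'Q hq)).1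
      have h1 : ‖c q.1‖ₑ ≤ ENNReal.ofReal Bc := by
        rw [← ofReal_norm]
        exact ENNReal.ofReal_le_ofReal (hBc q.1 hq1)
      exact ENNReal.rpow_le_rpow h1 (by norm_num)
    refine lt_of_le_of_lt hle ?_
    rw [setLIntegral_const]
    exact ENNReal.mul_lt_top (ENNReal.rpow_lt_top_of_nonneg (by norm_num) ENNReal.ofReal_ne_top)
      hK'.measure_lt_top
  refine ⟨?_, ?_, ⟨fun t x => fderiv ℝ (u t) x, ?_, ?_⟩, ?_⟩
  · -- interior conditions with the gauged pressure
    have h := (SereginSverak2002.isSuitableWeakSolutionOn_of_classical hclo (parabolicCylinderOpens ρ' z) hQ).sub_pressure hli hc32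
    exact h
  · -- `L^∞_t L²_x` on the ball, from the Type-I rate: `‖u‖ ≤ M τ^{-1/2}` on `[0,T]`
    have hrate0 : ∀ t ∈ Icc 0 T, ∀ x, ‖u t x‖ ≤ |M| * τ ^ (-(1 / 2 : ℝ)) := by
      intro t ht x
      have h1 := hrate t ht x
      have hs : τ ≤ T + τ - t := by linarith [ht.2]
      have h2 : (T + τ - t) ^ (-(1 / 2 : ℝ)) ≤ τ ^ (-(1 / 2 : ℝ)) :=
        Real.rpow_le_rpow_of_nonpos hτ hs (by norm_num)
      calc ‖u t x‖ ≤ M * (T + τ - t) ^ (-(1 / 2 : ℝ)) := h1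
        _ ≤ |M| * (T + τ - t) ^ (-(1 / 2 : ℝ)) :=
            mul_le_mul_of_nonneg_right (le_abs_self M) (Real.rpow_nonneg (by linarith) _)
        _ ≤ |M| * τ ^ (-(1 / 2 : ℝ)) := mul_le_mul_of_nonneg_left h2 (abs_nonneg M)
    set B : ℝ := |M| * τ ^ (-(1 / 2 : ℝ)) with hBdef
    have hfin : ENNReal.ofReal (B ^ 2) * volume (ball z.2 ρ') ≠ ⊤ :=
      ENNReal.mul_ne_top ENNReal.ofReal_ne_top measure_ball_lt_top.ne
    refine ⟨(ENNReal.ofReal (B ^ 2) * volume (ball z.2 ρ')).toNNReal, ?_⟩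
    rw [ENNReal.coe_toNNReal hfin]
    refine (ae_restrict_iff' measurableSet_Ioo).2 (ae_of_all _ fun t ht => ?_)
    have htI : t ∈ Icc 0 T := Ioo_subset_Icc_self ⟨by linarith [ht.1], by linarith [ht.2]⟩
    have hle : ∫⁻ x in ball z.2 ρ', ‖u t x‖ₑ ^ 2 ≤ ∫⁻ _ in ball z.2 ρ', ENNReal.ofReal (B ^ 2) := by
      refine setLIntegral_mono' measurableSet_ball fun x _ => ?_
      rw [← ofReal_norm, ← ENNReal.ofReal_pow (norm_nonneg _)]
      exact ENNReal.ofReal_le_ofReal (pow_le_pow_left₀ (norm_nonneg _) (hrate0 t htI x) 2)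
    rwa [setLIntegral_const] at hle
  · -- the classical slice derivative is a weak spatial gradient
    exact hasWeakSpatialGradientOn_of_contDiffOn isOpen_Ioo hQ hu1o
  · -- `∫∫_Q |∇u|² < ∞`: `Du` is continuous on the compact box `K`
    have hDc : ContinuousOn (fun q : ℝ × (EuclideanSpace ℝ (Fin 3)) => fderiv ℝ (u q.1) q.2) K :=
      (continuousOn_fderiv_slice_of_contDiffOn hu1 (uniqueDiffOn_Icc hT)).mono hKI
    obtain ⟨BD, hBD⟩ := hKc.exists_bound_of_continuousOn hDc
    have hle : ∫⁻ q in parabolicCylinder ρ' z, ENNReal.ofReal (frobeniusNormSq (fderiv ℝ (u q.1) q.2)) ≤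
        ∫⁻ _ in parabolicCylinder ρ' z, ENNReal.ofReal (3 * BD ^ 2) := by
      refine setLIntegral_mono' (isOpen_parabolicCylinder ρ' z).measurableSet fun q hq => ?_
      refine ENNReal.ofReal_le_ofReal ((ChaeLocalLeray.frobeniusNormSq_le_three _).trans ?_)
      have h1 := hBD q (hQK hq)
      have h0 : 0 ≤ ‖fderiv ℝ (u q.1) q.2‖ := norm_nonneg _
      nlinarith
    refine lt_of_le_of_lt hle ?_
    rw [setLIntegral_const]
    exact ENNReal.mul_lt_top ENNReal.ofReal_lt_top hQfin.lt_top
  · -- `p̃ ∈ L^{3/2}(Q)`: continuous on the compact box, bounded, finite measure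
    have hpK : ContinuousOn (uncurry (ballGauge p z.2 ρ)) K := by
      have e : uncurry (ballGauge p z.2 ρ) = fun q : ℝ × (EuclideanSpace ℝ (Fin 3)) => uncurry p q - c q.1 := by
        funext q; rfl
      rw [e]
      exact (hpc.mono hKI).sub (hcc.comp continuous_fst.continuousOn fun q hq => (hKI hq).1)
    obtain ⟨Bp, hBp⟩ := hKc.exists_bound_of_continuousOn hpK
    haveI : IsFiniteMeasure (volume.restrict (parabolicCylinder ρ' z)) := isFiniteMeasure_restrict.2 hQfin
    refine MemLp.of_bound ((hpK.mono hQK).aestronglyMeasurable (isOpen_parabolicCylinder ρ' z).measurableSet) Bp ?_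
    exact (ae_restrict_mem (isOpen_parabolicCylinder ρ' z).measurableSet).mono fun q hq => hBp q (hQK hq)

/-- **CS2 — `stub_coldPressureGauge : ColdPressureGauge` (BY NAME)**: halves (a) `isSuitableWeakSolutionInBall_ballGauge` and (b)
`cknD_ballGauge_le`. -/
theorem stub_coldPressureGauge : ColdPressureGauge := by
  intro M _hM
  obtain ⟨C₂, hC₂, h⟩ := cknD_ballGauge_le M
  refine ⟨C₂, hC₂, ?_⟩
  intro T τ u p hframe hτ hrate z ρ hρ hρz hzT
  refine ⟨fun ρ' hρ' hρ'ρ => ?_, h T τ u p hframe hτ hrate z ρ hρ hρz hzT⟩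
  have hρ'z : ρ' ^ 2 ≤ z.1 := (pow_le_pow_left₀ hρ'.le hρ'ρ 2).trans hρz
  exact isSuitableWeakSolutionInBall_ballGauge hframe hτ hrate hρ' hρ'z hzT

end Summit.NavierStokesRegularity.NavierStokesRegularity.Cruxes.TypeIQuantSubcubicExp.ColdSmoothing

end
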